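import Mathlib
import HarnessLib
import Summits.SmoothPoincare4.Statement
import Literature.Topology.FourManifolds.HomotopySpheres
import Literature.Topology.FourManifolds.Gluing
import Literature.Topology.FourManifolds.Handles
import Summits.SmoothPoincare4.SmoothPoincare4.Theses.RootDecompAE
import Summits.SmoothPoincare4.SmoothPoincare4.Theses.RootDecompV

/-!
# Line «axis_doubles» for the crux `RootDecompV.RecAxis` (V.A, stmt-SmoothPoincare4-29823, route-SmoothPoincare4-RootDecompV) — W1 skeleton

decomp-sp4 lens 2 «structural dichotomy», gen 12 (node «AxisTwistedDoubles», kernel `v12/AxisDoubles.lean`, card `v12/lines/axis_doubles.md`).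
A homotopy 4-sphere with an involution fixing a CIRCLE is (anti-invariant splitting) an INVOLUTORY TWISTED DOUBLE C ∪_ψ C, ψ = τ|_{∂C} an axial
involution of the seam; the dichotomy is on the half C: CONTRACTIBLE (cork seam / extendable seam — the instrumented, partly decided populations of
route AE: kernel AE.PTD #31476 ⟹ stub_axisCorkSeams, AE.DS #31477 ⟹ stub_axisExtendableSeams) versus NOT contractible (the generic cell, expected home
of the Aitchison–Rubinstein involutions on the Cappell–Shaneson spheres; count once with AD).

  RecAxis_of : stub_axisSplitting → stub_axisCorkSeams → stub_axisExtendableSeams → stub_axisNonAcyclic ⟹ RootDecompV.RecAxis   (hypothesis-free, 0 sorry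
  outside the four registered stubs; excluded middle on «C contractible» and on «ψ extends over C»).

Stub statements = the node kernel's `AxisSplitting`, `AxisCorkSeams`, `AxisExtendableSeams`, `AxisNonAcyclicPieces` with `IsAxialInvolution`, `S4`, `S1`
unfolded.  Stub names are distinct from the registered lines mazur_seams (#32000) and seam_rigidity (#32001).
-/

set_option linter.dupNamespace false

noncomputable section

open scoped Manifold ContDiff Topology
open Set Function Literature.Topology.FourManifolds

namespace Summit.SmoothPoincare4.SmoothPoincare4.Cruxes.RecAxis.AxisDoubles

/-- **stub_axisSplitting — ANTI-INVARIANT SPLITTING** (STRUCTURE · COSTUME(cite) · unconditional, NOT S-implied; size L–XL to formalise): a homotopy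
4-sphere M with an involution τ ≠ id whose fixed set is a circle is, with its own smooth structure, the involutory twisted double `IsBoundaryGluing bC bC ψ
(𝓡 4) M` of a compact half C = {f ≥ 0} (f = g − g∘τ generic anti-invariant; 0 regular since τ reverses orientation: dτ = diag(1,−1,−1,−1) on Fix τ) by the
axial involution ψ = τ|_{f=0}, Fix ψ = Fix τ ≅ S¹.  [corpus:book:gordon1984-four-manifold-theory pp. 8–10 (Aitchison–Rubinstein §1–2); Bredon 1972 VI.] -/
theorem stub_axisSplitting :
    ∀ (M : Type) [TopologicalSpace M] [T2Space M] [SecondCountableTopology M] [ChartedSpace (EuclideanSpace ℝ (Fin 4)) M]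
      [IsManifold (𝓡 4) ∞ M] (τ : M ≃ₘ⟮𝓡 4, 𝓡 4⟯ M),
      ContinuousMap.HomotopyEquiv M (Metric.sphere (0 : EuclideanSpace ℝ (Fin 5)) 1) → (∀ x, τ (τ x) = x) → (∃ x, τ x ≠ x) →
      Nonempty (Function.fixedPoints τ ≃ₜ Metric.sphere (0 : EuclideanSpace ℝ (Fin 2)) 1) →
      ∃ (C : Type) (_ : TopologicalSpace C) (_ : T2Space C) (_ : SecondCountableTopology C) (_ : ChartedSpace (EuclideanHalfSpace 4) C)
        (_ : IsManifold (𝓡∂ 4) ∞ C) (_ : CompactSpace C) (bC : BoundaryData (𝓡∂ 4) C (𝓡 3))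
        (ψ : bC.carrier ≃ₘ⟮𝓡 3, 𝓡 3⟯ bC.carrier),
        ((∀ z, ψ (ψ z) = z) ∧ Nonempty (Function.fixedPoints ψ ≃ₜ Metric.sphere (0 : EuclideanSpace ℝ (Fin 2)) 1)) ∧
          IsBoundaryGluing bC bC ψ (𝓡 4) M := by
  sorry

/-- **stub_axisCorkSeams — AXIS CORK SEAMS ARE STANDARD** (crux · species R · SPECIAL cell · UNDECIDED · ATTACKABLE · INSTRUMENTABLE (census T-SEAM /
T-SL); kernel AE.PeriodicTwistedDoublesStandard #31476 ⟹ this (n = 2) — COUNT ONCE with AE.STD #32000 ∧ AE.NTD #32001): for every compact CONTRACTIBLE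
smooth C, boundary datum bC and axial involution ψ of ∂C (ψ² = id, Fix ψ ≅ S¹) NOT extending over C, every homotopy 4-sphere X = C ∪_ψ C is S⁴.  Rows:
all Brieskorn Mazur corks (C, τ_S) (g10 MCS: τ_S = Montesinos involution, Fix = lifted branch knot), strongly-invertible hyperbolic cork seams;
DECIDED: ∂W = Σ(2,5,7) (Akbulut–Kirby 1979), symmetric-Mazur-link corks W_n, W̄_n, positrons (SL-2, [corpus:paper:arxiv-0806.3010 p.4–5]); UNDECIDED:
Casson–Harer / Stern fillings [corpus:book:gordon1984-four-manifold-theory p.463]. -/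
theorem stub_axisCorkSeams :
    ∀ (C : Type) [TopologicalSpace C] [T2Space C] [SecondCountableTopology C] [ChartedSpace (EuclideanHalfSpace 4) C]
      [IsManifold (𝓡∂ 4) ∞ C] [CompactSpace C] [ContractibleSpace C] (bC : BoundaryData (𝓡∂ 4) C (𝓡 3))
      (ψ : bC.carrier ≃ₘ⟮𝓡 3, 𝓡 3⟯ bC.carrier),
      ((∀ z, ψ (ψ z) = z) ∧ Nonempty (Function.fixedPoints ψ ≃ₜ Metric.sphere (0 : EuclideanSpace ℝ (Fin 2)) 1)) →
      (¬ ∃ Φ : C ≃ₘ⟮𝓡∂ 4, 𝓡∂ 4⟯ C, ∀ z, Φ (bC.incl z) = bC.incl (ψ z)) →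
      ∀ (X : Type) [TopologicalSpace X] [T2Space X] [SecondCountableTopology X] [ChartedSpace (EuclideanSpace ℝ (Fin 4)) X]
        [IsManifold (𝓡 4) ∞ X], ContinuousMap.HomotopyEquiv X (Metric.sphere (0 : EuclideanSpace ℝ (Fin 5)) 1) →
        IsBoundaryGluing bC bC ψ (𝓡 4) X → Nonempty (X ≃ₘ⟮𝓡 4, 𝓡 4⟯ Metric.sphere (0 : EuclideanSpace ℝ (Fin 5)) 1) := by
  sorry

/-- **stub_axisExtendableSeams — AXIS EXTENDABLE SEAMS ARE STANDARD** (support-grade · kernel AE.ContractibleDoublesStandard #31477 ⟹ this via the tree's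
`IsBoundaryGluing.isDouble_of_extends` — COUNT ONCE with AE.DS / V.RecMirror / C.PresentationSpheres #26154; DECIDED TRUE on Mazur-type pieces by the tree's
Mazur theorem; for Mazur pieces «ψ extends» ⟺ the seam certificate SL-1 «ψ(β) ≃ β» by the Hayden–Mark–Piccirillo marking transfer
[corpus:paper:arxiv-1908.05269 p.3, p.8]): compact contractible C, axial involution ψ of ∂C extending to a diffeomorphism of C, X = C ∪_ψ C ≃ₕ S⁴ ⟹ X ≅ S⁴. -/
theorem stub_axisExtendableSeams :
    ∀ (C : Type) [TopologicalSpace C] [T2Space C] [SecondCountableTopology C] [ChartedSpace (EuclideanHalfSpace 4) C]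
      [IsManifold (𝓡∂ 4) ∞ C] [CompactSpace C] [ContractibleSpace C] (bC : BoundaryData (𝓡∂ 4) C (𝓡 3))
      (ψ : bC.carrier ≃ₘ⟮𝓡 3, 𝓡 3⟯ bC.carrier),
      ((∀ z, ψ (ψ z) = z) ∧ Nonempty (Function.fixedPoints ψ ≃ₜ Metric.sphere (0 : EuclideanSpace ℝ (Fin 2)) 1)) →
      (∃ Φ : C ≃ₘ⟮𝓡∂ 4, 𝓡∂ 4⟯ C, ∀ z, Φ (bC.incl z) = bC.incl (ψ z)) →
      ∀ (X : Type) [TopologicalSpace X] [T2Space X] [SecondCountableTopology X] [ChartedSpace (EuclideanSpace ℝ (Fin 4)) X]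
        [IsManifold (𝓡 4) ∞ X], ContinuousMap.HomotopyEquiv X (Metric.sphere (0 : EuclideanSpace ℝ (Fin 5)) 1) →
        IsBoundaryGluing bC bC ψ (𝓡 4) X → Nonempty (X ≃ₘ⟮𝓡 4, 𝓡 4⟯ Metric.sphere (0 : EuclideanSpace ℝ (Fin 5)) 1) := by
  sorry

/-- **stub_axisNonAcyclic — AXIS TWISTED DOUBLES WITH NON-CONTRACTIBLE HALVES ARE STANDARD** (crux · GENERIC cell · UNDECIDED · IDEA-NEEDED · INSTRUMENTABLE
(T-AXIS: cell membership of each Cappell–Shaneson row = «is the anti-invariant seam an integral homology sphere?»); COUNT ONCE with AD on the CS rows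
[corpus:book:gordon1984-four-manifold-theory p.8, p.10 Thm 2.1]; decided TRUE on the standard CS families [corpus:paper:arxiv-0907.0136],
[corpus:paper:arxiv-2404.05096]): compact smooth C NOT contractible, axial involution ψ of ∂C, X = C ∪_ψ C ≃ₕ S⁴ ⟹ X ≅ S⁴. -/
theorem stub_axisNonAcyclic :
    ∀ (C : Type) [TopologicalSpace C] [T2Space C] [SecondCountableTopology C] [ChartedSpace (EuclideanHalfSpace 4) C]
      [IsManifold (𝓡∂ 4) ∞ C] [CompactSpace C] (bC : BoundaryData (𝓡∂ 4) C (𝓡 3))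
      (ψ : bC.carrier ≃ₘ⟮𝓡 3, 𝓡 3⟯ bC.carrier),
      ((∀ z, ψ (ψ z) = z) ∧ Nonempty (Function.fixedPoints ψ ≃ₜ Metric.sphere (0 : EuclideanSpace ℝ (Fin 2)) 1)) →
      ¬ ContractibleSpace C →
      ∀ (X : Type) [TopologicalSpace X] [T2Space X] [SecondCountableTopology X] [ChartedSpace (EuclideanSpace ℝ (Fin 4)) X]
        [IsManifold (𝓡 4) ∞ X], ContinuousMap.HomotopyEquiv X (Metric.sphere (0 : EuclideanSpace ℝ (Fin 5)) 1) →
        IsBoundaryGluing bC bC ψ (𝓡 4) X → Nonempty (X ≃ₘ⟮𝓡 4, 𝓡 4⟯ Metric.sphere (0 : EuclideanSpace ℝ (Fin 5)) 1) := by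
  sorry

/-- **THE COMPOSITION (kernel-checked, hypothesis-free, concludes the crux BY NAME)**: V.RecAxis from the four registered stubs. -/
theorem RecAxis_of : Summit.SmoothPoincare4.SmoothPoincare4.Theses.RootDecompV.RecAxis := by
  intro M _ _ _ _ _ τ e hτ hne hax
  obtain ⟨C, i₁, i₂, i₃, i₄, i₅, i₆, bC, ψ, hψ, hglue⟩ := stub_axisSplitting M τ e hτ hne hax
  by_cases hc : ContractibleSpace C
  · by_cases hext : ∃ Φ : C ≃ₘ⟮𝓡∂ 4, 𝓡∂ 4⟯ C, ∀ z, Φ (bC.incl z) = bC.incl (ψ z)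
    · exact stub_axisExtendableSeams C bC ψ hψ hext M e hglue
    · exact stub_axisCorkSeams C bC ψ hψ hext M e hglue
  · exact stub_axisNonAcyclic C bC ψ hψ hc M e hglue

end Summit.SmoothPoincare4.SmoothPoincare4.Cruxes.RecAxis.AxisDoubles
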